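import Mathlib
import HarnessLib

/-!
# Route RamseyUncertifiable, crux `PaleySosRung` (stmt-PneNP-9817), line `weil-patch-transfer`:
# star expansion of codegrees (helpers for `stub_smallBiasCodegrees`, part 1)

Deterministic algebra behind the probabilistic stub `stub_smallBiasCodegrees`. For a graph `G`
with signs `s(x,w) = ±1` (`+1` iff `x ∼ w`), the star indicator
`τ(A,w) = 2^{|A|}·1[A ⊆ N(w)] − 1` expands as `Σ_{∅ ≠ F ⊆ A} Π_{x∈F} s(x,w)` (`starInd_eq_sum`),
products of two sign characters multiply to the character of the symmetric difference
(`prod_mul_prod_eq_prod_symmDiff`), and hence the STAR CODEGREE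
`Σ_{w ∉ A∪A'} τ(A,w)τ(A',w)` differs from `(2^{|A∩A'|} − 1)(|V| − |A ∪ A'|)` by a signed sum of at
most `2^{|A|}·2^{|A'|}` star sums `S_Q = Σ_{w ∉ A ∪ A'} Π_{x ∈ Q} s(x,w)` with `∅ ≠ Q ⊆ A ∪ A'`
(`codeg_deviation_le`). No probability here, and no definitions are introduced (signs are written
as explicit `if … then 1 else -1`). The star indicators `if ∀ x ∈ A, G.Adj x w then … else …`
are stated over an ARBITRARY decidability instance (instance binders), so that the lemmas apply
verbatim in the `Fin m` context of the stub (where Lean decides `∀ x ∈ A, …` through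
`Nat.decidableForallFin`). [folklore]
-/

set_option linter.dupNamespace false -- `Summit.PneNP.PneNP.…`: summit = sub-problem (D-0017)

namespace Summit.PneNP.PneNP.Theorems.PaleySosRungWeilPatch

open Finset
open scoped symmDiff

variable {V : Type*} [DecidableEq V]

/-- For a function `s` with `s x * s x = 1` everywhere (e.g. `±1`-valued), the product over `F`
times the product over `F'` is the product over the symmetric difference `F ∆ F'`. [folklore] -/
theorem prod_mul_prod_eq_prod_symmDiff (s : V → ℝ) (hs : ∀ x, s x * s x = 1) (F F' : Finset V) :
    (∏ x ∈ F, s x) * (∏ x ∈ F', s x) = ∏ x ∈ F ∆ F', s x := by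
  have hF : ∏ x ∈ F, s x = (∏ x ∈ F \ F', s x) * ∏ x ∈ F ∩ F', s x := by
    rw [← prod_sdiff inter_subset_left, sdiff_inter_self_left]
  have hF' : ∏ x ∈ F', s x = (∏ x ∈ F' \ F, s x) * ∏ x ∈ F ∩ F', s x := by
    rw [← prod_sdiff inter_subset_right, sdiff_inter_self_right]
  have hsq : (∏ x ∈ F ∩ F', s x) * ∏ x ∈ F ∩ F', s x = 1 := by
    rw [← prod_mul_distrib]
    exact prod_eq_one fun x _ => hs x
  rw [Finset.symmDiff_def, prod_union disjoint_sdiff_sdiff, hF, hF']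
  calc (∏ x ∈ F \ F', s x) * (∏ x ∈ F ∩ F', s x) * ((∏ x ∈ F' \ F, s x) * ∏ x ∈ F ∩ F', s x)
        = (∏ x ∈ F \ F', s x) * (∏ x ∈ F' \ F, s x) *
            ((∏ x ∈ F ∩ F', s x) * ∏ x ∈ F ∩ F', s x) := by ring
    _ = (∏ x ∈ F \ F', s x) * ∏ x ∈ F' \ F, s x := by rw [hsq, mul_one]

/-- Star-indicator expansion: `2^{|A|}·1[∀ x ∈ A, x ∼ w] − 1 = Σ_{∅ ≠ F ⊆ A} Π_{x ∈ F} s(x,w)`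
with `s(x,w) = +1` if `x ∼ w` and `-1` otherwise (from `Π_{x∈A} (1 + s(x,w))`). [folklore] -/
theorem starInd_eq_sum (G : SimpleGraph V) [DecidableRel G.Adj] (A : Finset V) (w : V)
    [Decidable (∀ x ∈ A, G.Adj x w)] :
    (if ∀ x ∈ A, G.Adj x w then (2 : ℝ) ^ A.card - 1 else -1) =
      ∑ F ∈ A.powerset.erase ∅, ∏ x ∈ F, (if G.Adj x w then (1 : ℝ) else -1) := by
  have hprod : ∏ x ∈ A, (1 + (if G.Adj x w then (1 : ℝ) else -1)) =
      if ∀ x ∈ A, G.Adj x w then (2 : ℝ) ^ A.card else 0 := by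
    split_ifs with h
    · rw [← prod_const (2 : ℝ)]
      exact prod_congr rfl fun x hx => by rw [if_pos (h x hx)]; norm_num
    · push Not at h
      obtain ⟨x, hx, hxw⟩ := h
      exact prod_eq_zero hx (by rw [if_neg hxw]; norm_num)
  have hsum := prod_one_add (f := fun x => if G.Adj x w then (1 : ℝ) else -1) A
  rw [← add_sum_erase _ _ (empty_mem_powerset A), prod_empty] at hsum
  have hsum' : ∑ F ∈ A.powerset.erase ∅, ∏ x ∈ F, (if G.Adj x w then (1 : ℝ) else -1) =
      (∏ x ∈ A, (1 + (if G.Adj x w then (1 : ℝ) else -1))) - 1 := by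
    rw [hsum]; ring
  rw [hsum', hprod]
  split_ifs <;> ring

/-- Pointwise product of two star indicators as a double sum of sign characters of symmetric
differences: `τ(A,w) τ(A',w) = Σ_{∅≠F⊆A} Σ_{∅≠F'⊆A'} Π_{x ∈ F ∆ F'} s(x,w)`. [folklore] -/
theorem starInd_mul_starInd (G : SimpleGraph V) [DecidableRel G.Adj] (A A' : Finset V) (w : V)
    [Decidable (∀ x ∈ A, G.Adj x w)] [Decidable (∀ x ∈ A', G.Adj x w)] :
    (if ∀ x ∈ A, G.Adj x w then (2 : ℝ) ^ A.card - 1 else -1) *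
        (if ∀ x ∈ A', G.Adj x w then (2 : ℝ) ^ A'.card - 1 else -1) =
      ∑ F ∈ A.powerset.erase ∅, ∑ F' ∈ A'.powerset.erase ∅,
        ∏ x ∈ F ∆ F', (if G.Adj x w then (1 : ℝ) else -1) := by
  rw [starInd_eq_sum, starInd_eq_sum, sum_mul_sum]
  refine sum_congr rfl fun F _ => sum_congr rfl fun F' _ => ?_
  exact prod_mul_prod_eq_prod_symmDiff _ (fun x => by split_ifs <;> norm_num) F F'

/-- The star codegree over a vertex set `U` as a double sum of star sums:
`Σ_{w∈U} τ(A,w)τ(A',w) = Σ_{∅≠F⊆A} Σ_{∅≠F'⊆A'} Σ_{w ∈ U} Π_{x ∈ F ∆ F'} s(x,w)`. [folklore] -/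
theorem codeg_eq_sum (G : SimpleGraph V) [DecidableRel G.Adj] (A A' U : Finset V)
    [∀ w, Decidable (∀ x ∈ A, G.Adj x w)] [∀ w, Decidable (∀ x ∈ A', G.Adj x w)] :
    ∑ w ∈ U, (if ∀ x ∈ A, G.Adj x w then (2 : ℝ) ^ A.card - 1 else -1) *
        (if ∀ x ∈ A', G.Adj x w then (2 : ℝ) ^ A'.card - 1 else -1) =
      ∑ F ∈ A.powerset.erase ∅, ∑ F' ∈ A'.powerset.erase ∅,
        ∑ w ∈ U, ∏ x ∈ F ∆ F', (if G.Adj x w then (1 : ℝ) else -1) := by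
  rw [sum_congr rfl fun w _ => starInd_mul_starInd G A A' w, sum_comm]
  refine sum_congr rfl fun F _ => ?_
  rw [sum_comm]

/-- The nonempty subsets common to `A` and `A'` are the nonempty subsets of `A ∩ A'`. -/
theorem filter_powerset_erase_mem (A A' : Finset V) :
    (A.powerset.erase ∅).filter (fun F => F ∈ A'.powerset.erase ∅) = (A ∩ A').powerset.erase ∅ := by
  ext F
  simp only [mem_filter, mem_erase, mem_powerset, subset_inter_iff]
  tauto

/-- **Codegree deviation bound (deterministic).** If every star sum
`S_Q = Σ_{w ∉ A ∪ A'} Π_{x∈Q} s(x,w)` with `∅ ≠ Q ⊆ A ∪ A'` has `|S_Q| ≤ λ` (`λ ≥ 0`), then the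
star codegree `Σ_{w ∉ A ∪ A'} τ(A,w) τ(A',w)` is within `2^{|A|}·2^{|A'|}·λ` of
`(2^{|A ∩ A'|} − 1)(|V| − |A ∪ A'|)`. Proof: in the double sum of `codeg_eq_sum` the diagonal
pairs `F = F'` (necessarily `∅ ≠ F ⊆ A ∩ A'`, `2^{|A∩A'|} − 1` of them) contribute `|U|` each, and
every off-diagonal pair contributes a star sum `S_{F ∆ F'}` with `∅ ≠ F ∆ F' ⊆ A ∪ A'`.
[folklore] -/
theorem codeg_deviation_le [Fintype V] (G : SimpleGraph V) [DecidableRel G.Adj] (A A' : Finset V)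
    [∀ w, Decidable (∀ x ∈ A, G.Adj x w)] [∀ w, Decidable (∀ x ∈ A', G.Adj x w)]
    {lam : ℝ} (hlam : 0 ≤ lam)
    (h : ∀ Q, Q ⊆ A ∪ A' → Q.Nonempty →
      |∑ w ∈ univ \ (A ∪ A'), ∏ x ∈ Q, (if G.Adj x w then (1 : ℝ) else -1)| ≤ lam) :
    |(∑ w ∈ univ \ (A ∪ A'), (if ∀ x ∈ A, G.Adj x w then (2 : ℝ) ^ A.card - 1 else -1) *
          (if ∀ x ∈ A', G.Adj x w then (2 : ℝ) ^ A'.card - 1 else -1)) -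
        ((2 : ℝ) ^ (A ∩ A').card - 1) * ((Fintype.card V : ℝ) - ((A ∪ A').card : ℝ))|
      ≤ 2 ^ A.card * 2 ^ A'.card * lam := by
  set U : Finset V := univ \ (A ∪ A') with hU
  set P : Finset (Finset V) := A.powerset.erase ∅ with hP
  set P' : Finset (Finset V) := A'.powerset.erase ∅ with hP'
  set S : Finset V → ℝ := fun Q => ∑ w ∈ U, ∏ x ∈ Q, (if G.Adj x w then (1 : ℝ) else -1)
    with hS
  -- the mean term
  have hUcard : (U.card : ℝ) = (Fintype.card V : ℝ) - ((A ∪ A').card : ℝ) := by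
    rw [hU, card_univ_sdiff, Nat.cast_sub (card_le_univ _)]
  have hS0 : S ∅ = (U.card : ℝ) := by
    simp [hS]
  have hdiag_card : (((A ∩ A').powerset.erase ∅).card : ℝ) = (2 : ℝ) ^ (A ∩ A').card - 1 := by
    rw [card_erase_of_mem (empty_mem_powerset _), card_powerset, Nat.cast_sub Nat.one_le_two_pow]
    push_cast
    ring
  -- Step 1: expand the codegree
  have h1 := codeg_eq_sum G A A' U
  -- Step 2: split off the diagonal
  have h2 : ∀ F ∈ P, ∑ F' ∈ P', S (F ∆ F') =
      (if F ∈ P' then (U.card : ℝ) else 0) + ∑ F' ∈ P', (if F = F' then 0 else S (F ∆ F')) := by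
    intro F _
    have : ∀ F' ∈ P', S (F ∆ F') =
        (if F = F' then S (F ∆ F') else 0) + (if F = F' then 0 else S (F ∆ F')) := by
      intro F' _
      split_ifs <;> ring
    rw [sum_congr rfl this, sum_add_distrib, sum_ite_eq]
    congr 1
    split_ifs with hF
    · rw [symmDiff_self, Finset.bot_eq_empty, hS0]
    · rfl
  have h3 : ∑ F ∈ P, ∑ F' ∈ P', S (F ∆ F') =
      (((A ∩ A').powerset.erase ∅).card : ℝ) * (U.card : ℝ) +
        ∑ F ∈ P, ∑ F' ∈ P', (if F = F' then 0 else S (F ∆ F')) := by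
    rw [sum_congr rfl h2, sum_add_distrib, ← sum_filter, filter_powerset_erase_mem, sum_const,
      nsmul_eq_mul]
  -- Step 3: bound the off-diagonal part
  have hoff : ∀ F ∈ P, ∀ F' ∈ P', |(if F = F' then 0 else S (F ∆ F'))| ≤ lam := by
    intro F hF F' hF'
    split_ifs with hFF'
    · rwa [abs_zero]
    · refine h (F ∆ F') ?_ (symmDiff_nonempty.2 hFF')
      have hFA : F ⊆ A := mem_powerset.1 (mem_of_mem_erase hF)
      have hFA' : F' ⊆ A' := mem_powerset.1 (mem_of_mem_erase hF')
      exact symmDiff_subset_union.trans (union_subset_union hFA hFA')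
  have h4 : |∑ F ∈ P, ∑ F' ∈ P', (if F = F' then 0 else S (F ∆ F'))| ≤
      2 ^ A.card * 2 ^ A'.card * lam := by
    calc |∑ F ∈ P, ∑ F' ∈ P', (if F = F' then 0 else S (F ∆ F'))|
          ≤ ∑ F ∈ P, |∑ F' ∈ P', (if F = F' then 0 else S (F ∆ F'))| := abs_sum_le_sum_abs _ _
      _ ≤ ∑ F ∈ P, ∑ F' ∈ P', |(if F = F' then 0 else S (F ∆ F'))| :=
          sum_le_sum fun F _ => abs_sum_le_sum_abs _ _
      _ ≤ ∑ F ∈ P, ∑ F' ∈ P', lam :=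
          sum_le_sum fun F hF => sum_le_sum fun F' hF' => hoff F hF F' hF'
      _ = (P.card : ℝ) * ((P'.card : ℝ) * lam) := by
          rw [sum_const, sum_const, nsmul_eq_mul, nsmul_eq_mul]
      _ ≤ 2 ^ A.card * (2 ^ A'.card * lam) := by
          have hPc : (P.card : ℝ) ≤ 2 ^ A.card := by
            rw [hP]
            exact_mod_cast (card_erase_le).trans (card_powerset A).le
          have hP'c : (P'.card : ℝ) ≤ 2 ^ A'.card := by
            rw [hP']
            exact_mod_cast (card_erase_le).trans (card_powerset A').le
          have hP'l : (P'.card : ℝ) * lam ≤ 2 ^ A'.card * lam :=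
            mul_le_mul_of_nonneg_right hP'c hlam
          exact mul_le_mul hPc hP'l (by positivity) (by positivity)
      _ = 2 ^ A.card * 2 ^ A'.card * lam := by ring
  -- assemble
  have hmain : (∑ w ∈ U, (if ∀ x ∈ A, G.Adj x w then (2 : ℝ) ^ A.card - 1 else -1) *
        (if ∀ x ∈ A', G.Adj x w then (2 : ℝ) ^ A'.card - 1 else -1)) -
      ((2 : ℝ) ^ (A ∩ A').card - 1) * ((Fintype.card V : ℝ) - ((A ∪ A').card : ℝ)) =
      ∑ F ∈ P, ∑ F' ∈ P', (if F = F' then 0 else S (F ∆ F')) := by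
    rw [h1, ← hUcard, ← hdiag_card]
    change ∑ F ∈ P, ∑ F' ∈ P', S (F ∆ F') - _ = _
    rw [h3]
    ring
  rw [hmain]
  exact h4

/-- **Registered sub-goal `sbc_codegDeviation`** (credits this helper file to stmt-PneNP-9817):
the deterministic codegree deviation bound `codeg_deviation_le`, restated as a closed one-line
proposition with an explicit binder order. [folklore] -/
theorem sbc_codegDeviation :
    ∀ {V : Type*} [Fintype V] [DecidableEq V] (G : SimpleGraph V) [DecidableRel G.Adj]
      (A A' : Finset V) [∀ w, Decidable (∀ x ∈ A, G.Adj x w)]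
      [∀ w, Decidable (∀ x ∈ A', G.Adj x w)] (lam : ℝ), 0 ≤ lam →
      (∀ Q : Finset V, Q ⊆ A ∪ A' → Q.Nonempty →
        |∑ w ∈ Finset.univ \ (A ∪ A'), ∏ x ∈ Q, (if G.Adj x w then (1 : ℝ) else -1)| ≤ lam) →
      |(∑ w ∈ Finset.univ \ (A ∪ A'),
          (if ∀ x ∈ A, G.Adj x w then (2 : ℝ) ^ A.card - 1 else -1) *
          (if ∀ x ∈ A', G.Adj x w then (2 : ℝ) ^ A'.card - 1 else -1)) -
        ((2 : ℝ) ^ (A ∩ A').card - 1) * ((Fintype.card V : ℝ) - ((A ∪ A').card : ℝ))|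
        ≤ (2 : ℝ) ^ A.card * (2 : ℝ) ^ A'.card * lam := by
  intro V _ _ G _ A A' _ _ lam hlam h
  exact codeg_deviation_le G A A' hlam h

end Summit.PneNP.PneNP.Theorems.PaleySosRungWeilPatch
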